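import Summits.ResolutionOfSingularities.ResolutionOfSingularities.Theses.PAlteration
import Literature.AlgebraicGeometry.Resolution.AbhyankarValuationsLocalUniformization
import Literature.AlgebraicGeometry.Resolution.LocalUniformization
import HarnessLib

/-!
# `Pialt` (crux stmt-ResolutionOfSingularities-0555), line `SketchIdeator2`: the ABHYANKAR slice of
# the LU atom `stub_rrLU1Perfect` holds in every transcendence degree (open-range calibration)

Helper file of the line lead (c4) (`--supports stmt-ResolutionOfSingularities-0555`; it closes
no item). The registered skeleton `Cruxes/Pialt/Lines/SketchIdeator2.lean` (v4) has two open
atoms over PERFECT ground fields; the first, `stub_rrLU1Perfect` (local uniformization below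
height-one Frobenius sandwiches `K ⊆ L = K(y)`, `y ^ p ∈ K`, of regular affine varieties, i.e.
local uniformization ON `K` of the restriction `O ∩ K` of a valuation ring `O` of `L` dominating a
regular model of `L`), is equivalent, field by field and modulo `Temkin2013`, to local
uniformization in characteristic `p` over that perfect field — open from transcendence degree
`4` (`OpenRange.rrLU1Perfect_of_trdeg_le_three`, lead c3, p141077, gives it for `trdeg ≤ 3` modulo
`CossartPiltant2019`).

This file records the complementary calibration, UNCONDITIONAL and in EVERY transcendence degree:

* `rrLU1Perfect_of_transcendenceDefect_eq_zero` — the registered binders of `stub_rrLU1Perfect`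
  plus ONE hypothesis, `transcendenceDefect k (O ∩ K) = 0` (the valuation to be uniformized is
  ABHYANKAR: `E + F = tr.deg`): then the conclusion holds, by the Literature theorem
  `isLocallyUniformizable_of_transcendenceDefect_eq_zero` (Knaf–Kuhlmann 2005 Thm. 1.1 over a
  perfect field = Temkin 2013 Thm. 5.5.2 (i) with its purely inseparable `l/k` collapsed,
  PROVED in tree from `Temkin2013Abhyankar_holds` / `Kuhlmann2010Stability_holds`). The sandwich
  data `L`, `y`, `B`, `O` are idle: Abhyankar valuations of `K` are uniformized on `K` outright.
* `rrLU1Perfect_of_ratRank_add_residueTrdeg_eq` — the same with the hypothesis in Abhyankar's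
  printed form `E + F = tr.deg_k K`.

WHAT THIS MEANS for the disprover / planners: a counterexample to the LU atom (equivalently, to
local uniformization over a perfect field of characteristic `p`, modulo `Temkin2013`) must be a
valuation of POSITIVE transcendence defect (`E + F < tr.deg`, "defect room") in transcendence
degree `≥ 4`; divisorial and, more generally, all Abhyankar valuations are settled in every
dimension without any extension of `K`.
-/

set_option linter.dupNamespace false -- mandated namespace of this single-conjunct summit

noncomputable section

open Literature.AlgebraicGeometry.Resolution

namespace Summit.ResolutionOfSingularities.ResolutionOfSingularities.Theorems.Pialt.OpenRange

/-- **The Abhyankar slice of `stub_rrLU1Perfect`, every transcendence degree, unconditional.**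
Registered binders of the atom verbatim, plus the hypothesis that the valuation ring `O ∩ K` of
`K` has transcendence defect `0` over `k`; conclusion: `O ∩ K` is locally uniformizable over the
perfect field `k` (`isLocallyUniformizable_of_transcendenceDefect_eq_zero`; the sandwich `L`,
the generator `y`, the regular model `B` are not used). -/
theorem rrLU1Perfect_of_transcendenceDefect_eq_zero (p : ℕ) (_hp : p.Prime) :
    ∀ (k K L : Type) [Field k] [CharP k p] [PerfectField k] [Field K] [Field L] [Algebra k K]
      [Algebra K L] [Algebra k L] [IsScalarTower k K L], (⊤ : IntermediateField k K).FG →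
      IsPurelyInseparable K L →
      (∃ y : L, y ^ p ∈ (algebraMap K L).range ∧ IntermediateField.adjoin K {y} = ⊤) →
      ∀ B : Subalgebra k L, B.FG → IsFractionRing B L → IsRegularRing B →
      ∀ O : ValuationSubring L, B.toSubring ≤ O.toSubring →
      ∀ hk : (∀ c : k, algebraMap k K c ∈ O.comap (algebraMap K L)),
        transcendenceDefect k (O.comap (algebraMap K L)) hk = 0 →
        IsLocallyUniformizable k K (O.comap (algebraMap K L)) := by
  intro k K L _ _ _ _ _ _ _ _ _ hfg _ _ _ _ _ _ O _ hk h0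
  exact isLocallyUniformizable_of_transcendenceDefect_eq_zero hfg _ hk h0

/-- The same slice with the Abhyankar hypothesis in its printed form
`E(O ∩ K) + F(O ∩ K) = tr.deg_k K` (rational rank plus residual transcendence degree equal to the
transcendence degree; `transcendenceDefect_eq_zero_iff`). -/
theorem rrLU1Perfect_of_ratRank_add_residueTrdeg_eq (p : ℕ) (_hp : p.Prime) :
    ∀ (k K L : Type) [Field k] [CharP k p] [PerfectField k] [Field K] [Field L] [Algebra k K]
      [Algebra K L] [Algebra k L] [IsScalarTower k K L], (⊤ : IntermediateField k K).FG →
      IsPurelyInseparable K L →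
      (∃ y : L, y ^ p ∈ (algebraMap K L).range ∧ IntermediateField.adjoin K {y} = ⊤) →
      ∀ B : Subalgebra k L, B.FG → IsFractionRing B L → IsRegularRing B →
      ∀ O : ValuationSubring L, B.toSubring ≤ O.toSubring →
      ∀ hk : (∀ c : k, algebraMap k K c ∈ O.comap (algebraMap K L)),
        ratRank (O.comap (algebraMap K L)) + residueTrdeg k (O.comap (algebraMap K L)) hk =
          Algebra.trdeg k K →
        IsLocallyUniformizable k K (O.comap (algebraMap K L)) := by
  intro k K L _ _ _ _ _ _ _ _ _ hfg _ _ _ _ _ _ O _ hk hEF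
  exact isLocallyUniformizable_of_ratRank_add_residueTrdeg_eq hfg _ hk hEF

/-! ## The atom reduces to valuations of positive transcendence defect (lead c4, cycle 1 addendum) -/

/-- The ground field lies in the restricted valuation ring `O ∩ K` as soon as `O` dominates a
`k`-subalgebra `B` of `L` (`k ⊆ B ⊆ O`). -/
theorem algebraMap_mem_comap_of_subalgebra_le {k K L : Type} [Field k] [Field K] [Field L]
    [Algebra k K] [Algebra K L] [Algebra k L] [IsScalarTower k K L] (B : Subalgebra k L)
    (O : ValuationSubring L) (hBO : B.toSubring ≤ O.toSubring) (c : k) :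
    algebraMap k K c ∈ O.comap (algebraMap K L) := by
  rw [ValuationSubring.mem_comap, ← IsScalarTower.algebraMap_apply]
  exact hBO (B.algebraMap_mem c)

/-- **The LU atom `stub_rrLU1Perfect` reduces to local uniformization of valuations of POSITIVE
transcendence defect over perfect fields.** If, over every perfect field `k` of characteristic
`p`, every valuation ring `O ⊇ k` of every finitely generated `K/k` with `transcendenceDefect > 0`
(`E + F < tr.deg`) is locally uniformizable over `k`, then the atom holds (registered binders
verbatim): the Abhyankar case `transcendenceDefect = 0` is the unconditional
`isLocallyUniformizable_of_transcendenceDefect_eq_zero`. (Conversely the atom implies local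
uniformization over that perfect field only modulo `Temkin2013`:
`RadiciallyRegular.isLocallyUniformizable_of_temkin2013_of_rrLU1_at`.) The sandwich `L ⊇ K`, the
generator `y` and the regular model `B` are used only to see `k ⊆ O ∩ K`. -/
theorem rrLU1Perfect_of_forall_pos_transcendenceDefect (p : ℕ) (_hp : p.Prime)
    (hLU : ∀ (k K : Type) [Field k] [CharP k p] [PerfectField k] [Field K] [Algebra k K],
      (⊤ : IntermediateField k K).FG → ∀ (O : ValuationSubring K)
        (hk : ∀ c : k, algebraMap k K c ∈ O), 0 < transcendenceDefect k O hk →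
        IsLocallyUniformizable k K O) :
    ∀ (k K L : Type) [Field k] [CharP k p] [PerfectField k] [Field K] [Field L] [Algebra k K]
      [Algebra K L] [Algebra k L] [IsScalarTower k K L], (⊤ : IntermediateField k K).FG →
      IsPurelyInseparable K L →
      (∃ y : L, y ^ p ∈ (algebraMap K L).range ∧ IntermediateField.adjoin K {y} = ⊤) →
      ∀ B : Subalgebra k L, B.FG → IsFractionRing B L → IsRegularRing B →
      ∀ O : ValuationSubring L, B.toSubring ≤ O.toSubring →
        IsLocallyUniformizable k K (O.comap (algebraMap K L)) := by
  intro k K L _ _ _ _ _ _ _ _ _ hfg _ _ B _ _ _ O hBO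
  have hk : ∀ c : k, algebraMap k K c ∈ O.comap (algebraMap K L) :=
    algebraMap_mem_comap_of_subalgebra_le B O hBO
  rcases Nat.eq_zero_or_pos (transcendenceDefect k (O.comap (algebraMap K L)) hk) with h0 | hpos
  · exact isLocallyUniformizable_of_transcendenceDefect_eq_zero hfg _ hk h0
  · exact hLU k K hfg _ hk hpos

end Summit.ResolutionOfSingularities.ResolutionOfSingularities.Theorems.Pialt.OpenRange

end
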